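import Summits.NavierStokesRegularity.NavierStokesRegularity.Theorems.TypeIIInviscidRelaxationAxisymSwirlRegularZhangBarrierProfile
import HarnessLib

/-!
# An explicit half-line barrier for the drift `c/√(T−t)` (Zhang 2026, κ = 1), III: power bounds for the profile

Helper toward the crux `AxisymSwirlRegular` (stmt-NavierStokesRegularity-1964, route TypeIIInviscidRelaxation),
registered line `radial_inflow_split`, criterion side `stub_oneSidedRadialCriterion` (⟨19059⟩); continuation of
`…ZhangBarrierRiccati` / `…ZhangBarrierProfile`.

THIS FILE: the two-sided power bounds on the similarity profile `F = prof c` that give the DATA clauses of the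
barrier `w(r,t) = Λ(T−t)^m F(r/√(T−t))`:
* `prof_le` — `F(ξ) ≤ C₀ ξ^{2m}` on `[0,∞)` (`C₀ = (4c+3)(λ²+1)`): the Hölder modulus `w ≤ ΛC₀ r^{2m}`;
* `prof_ge_rpow` — `F(ξ) ≥ κ₁(ξ₁) ξ^{2m}` for `ξ ≥ ξ₁ > 0`: the lateral clause `w(1,t) ≥ 1`;
* `prof_ge_sq` — `F(ξ) ≥ κ₂(ξ₂) ξ²` for `0 ≤ ξ ≤ ξ₂`: the initial clause `w(r,0) ≥ min(r,1)²`.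
Ingredients: `(λξ/(λξ+2))² ≤ u ≤ min(1,(λξ)²)` (from `e^x ≥ 1+x`, `e^{x/2} ≥ 1+x/2`) and
`ξ/(4c+1)² ≤ e^{arsinh(ξ−2c)} = ξ − 2c + √(1+(ξ−2c)²) ≤ 2ξ + 4c + 1`.

Pure Mathlib real analysis; no NS statement here.
References: Qi S. Zhang, arXiv:2604.07785 (2026), §2 [Zhang2026PartialTypeI].
-/

noncomputable section

set_option linter.dupNamespace false

open Set Filter Topology Real

namespace Summit.NavierStokesRegularity.NavierStokesRegularity.Theorems.ZhangBarrier

/-! ## §4 Two-sided power bounds -/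

/-- `u ≤ 1` on `[0,∞)`. -/
theorem uu_le_one (c : ℝ) {ξ : ℝ} (hc : 0 < c) (hξ : 0 ≤ ξ) : uu c ξ ≤ 1 := by
  unfold uu
  have hl := lam_pos hc
  have : 0 ≤ exp (-(lam c * ξ)) * (1 + lam c * ξ) := by positivity
  linarith

/-- `u(ξ) ≤ (λξ)²` (from `e^{−x} ≥ 1 − x`). -/
theorem uu_le_sq (c : ℝ) {ξ : ℝ} (hc : 0 < c) (hξ : 0 ≤ ξ) : uu c ξ ≤ (lam c * ξ) ^ 2 := by
  have hl := lam_pos hc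
  set x := lam c * ξ with hx
  have hx0 : 0 ≤ x := by positivity
  rcases le_or_gt x 1 with h1 | h1
  · unfold uu
    rw [← hx]
    have he : 1 - x ≤ exp (-x) := by have := add_one_le_exp (-x); linarith
    have h2 : (1 - x) * (1 + x) ≤ exp (-x) * (1 + x) :=
      mul_le_mul_of_nonneg_right he (by linarith)
    nlinarith
  · have := uu_le_one c hc hξ
    nlinarith

/-- `u(ξ) ≥ (λξ/(λξ+2))²` (from `e^{x/2} ≥ 1 + x/2`). -/
theorem sq_le_uu (c : ℝ) {ξ : ℝ} (hc : 0 < c) (hξ : 0 ≤ ξ) :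
    (lam c * ξ / (lam c * ξ + 2)) ^ 2 ≤ uu c ξ := by
  have hl := lam_pos hc
  set x := lam c * ξ with hx
  have hx0 : 0 ≤ x := by positivity
  unfold uu; rw [← hx]
  set q := exp (x / 2) with hq
  have hq1 : (x + 2) / 2 ≤ q := by have := add_one_le_exp (x / 2); rw [hq]; linarith
  have hqpos : 0 < q := exp_pos _
  have hexp : exp (-x) = (q ^ 2)⁻¹ := by
    rw [hq, ← exp_nat_mul, ← exp_neg]; congr 1; push_cast; ring
  rw [hexp]
  have hq2 : ((x + 2) / 2) ^ 2 ≤ q ^ 2 := by gcongr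
  have hq2pos : 0 < q ^ 2 := by positivity
  have h3 : (q ^ 2)⁻¹ * (1 + x) ≤ (((x + 2) / 2) ^ 2)⁻¹ * (1 + x) := by
    apply mul_le_mul_of_nonneg_right _ (by linarith)
    exact inv_anti₀ (by positivity) hq2
  have e : (x / (x + 2)) ^ 2 = 1 - (((x + 2) / 2) ^ 2)⁻¹ * (1 + x) := by
    field_simp; ring
  rw [e]; linarith

/-- The growth constant `C₀ = (4c+3)(λ²+1)`. [new] -/
def C0 (c : ℝ) : ℝ := (4 * c + 3) * (lam c ^ 2 + 1)

/-- `C₀ > 0`. -/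
theorem C0_pos {c : ℝ} (hc : 0 < c) : 0 < C0 c := by unfold C0; have := lam_pos hc; positivity

/-- `exp(arsinh y) = y + √(1+y²) ≤ 2ξ + 4c + 1` for `y = ξ − 2c`, `ξ ≥ 0`. -/
theorem exp_arsinh_le {c ξ : ℝ} (hc : 0 < c) (hξ : 0 ≤ ξ) :
    exp (arsinh (ξ - 2 * c)) ≤ 2 * ξ + 4 * c + 1 := by
  rw [exp_arsinh]
  have h : √(1 + (ξ - 2 * c) ^ 2) ≤ 1 + (ξ + 2 * c) := by
    rw [sqrt_le_left (by positivity)]; nlinarith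
  linarith

/-- `exp(arsinh y) = y + √(1+y²) ≥ ξ/(4c+1)²` for `y = ξ − 2c`, `ξ ≥ 0`. -/
theorem le_exp_arsinh {c ξ : ℝ} (hc : 0 < c) (hξ : 0 ≤ ξ) :
    ξ / (4 * c + 1) ^ 2 ≤ exp (arsinh (ξ - 2 * c)) := by
  rw [exp_arsinh]
  set y := ξ - 2 * c with hy
  set S := √(1 + y ^ 2) with hS
  have hS0 : 0 < S := by rw [hS]; positivity
  have hSy : S ^ 2 = 1 + y ^ 2 := by rw [hS, sq_sqrt (by positivity)]
  have hS1 : 1 ≤ S := by nlinarith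
  have hyS : -y ≤ S := by nlinarith
  have hyS' : y ≤ S := by nlinarith
  have hc1 : 0 < (4 * c + 1) ^ 2 := by positivity
  rw [div_le_iff₀ hc1]
  rcases le_or_gt (4 * c) ξ with h4 | h4
  · -- `ξ ≥ 4c`: `y + S ≥ y + 1 = ξ − 2c + 1`, and `(ξ−2c+1)(4c+1)² ≥ ξ`
    have h0 : 0 ≤ y := by rw [hy]; linarith
    nlinarith [mul_nonneg h0 (by nlinarith : (0:ℝ) ≤ (4 * c + 1) ^ 2 - 1)]
  · -- `ξ < 4c`: `y + S = 1/(S − y) ≥ 1/(4c+1) ≥ ξ/(4c+1)²`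
    have hprod : (S - y) * (S + y) = 1 := by nlinarith
    have hSmy : S - y ≤ 4 * c + 1 := by
      have : S ≤ 1 + (2 * c) := by
        rw [hS, sqrt_le_left (by positivity)]
        have : -(2 * c) ≤ y := by rw [hy]; linarith
        have : y ≤ 2 * c := by rw [hy]; linarith
        nlinarith
      have : -y ≤ 2 * c := by rw [hy]; linarith
      linarith
    have hSpy : 0 < S + y := by nlinarith
    have h1 : 1 ≤ (4 * c + 1) * (S + y) := by nlinarith
    nlinarith

/-- `v ≤ (4c+3) ξ^{2m}` for `ξ ≥ 1`. -/
theorem vv_le_of_one_le {c ξ : ℝ} (hc : 0 < c) (hξ : 1 ≤ ξ) :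
    vv c ξ ≤ (4 * c + 3) * ξ ^ (2 * expo c) := by
  have hm := expo_pos c
  have hA := bigA_pos c
  unfold vv psi
  have h1 : expo c * (-(bigA c / c) * exp (-(c * ξ)) + 2 * arsinh (ξ - 2 * c))
      ≤ arsinh (ξ - 2 * c) * (2 * expo c) := by
    have : 0 ≤ bigA c / c * exp (-(c * ξ)) := by positivity
    nlinarith
  calc exp (expo c * (-(bigA c / c) * exp (-(c * ξ)) + 2 * arsinh (ξ - 2 * c)))
      ≤ exp (arsinh (ξ - 2 * c) * (2 * expo c)) := exp_le_exp.2 h1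
    _ = (exp (arsinh (ξ - 2 * c))) ^ (2 * expo c) := exp_mul _ _
    _ ≤ (2 * ξ + 4 * c + 1) ^ (2 * expo c) :=
        rpow_le_rpow (exp_pos _).le (exp_arsinh_le hc (by linarith)) (by positivity)
    _ ≤ ((4 * c + 3) * ξ) ^ (2 * expo c) :=
        rpow_le_rpow (by positivity) (by nlinarith) (by positivity)
    _ = (4 * c + 3) ^ (2 * expo c) * ξ ^ (2 * expo c) := mul_rpow (by positivity) (by linarith)
    _ ≤ (4 * c + 3) * ξ ^ (2 * expo c) := by
        apply mul_le_mul_of_nonneg_right _ (by positivity)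
        have h32 := expo_le c
        calc (4 * c + 3) ^ (2 * expo c) ≤ (4 * c + 3) ^ (1 : ℝ) :=
              rpow_le_rpow_of_exponent_le (by linarith) (by linarith)
          _ = 4 * c + 3 := rpow_one _

/-- `v ≤ 4c+3` for `0 ≤ ξ ≤ 1`. -/
theorem vv_le_of_le_one {c ξ : ℝ} (hc : 0 < c) (h0 : 0 ≤ ξ) (h1 : ξ ≤ 1) : vv c ξ ≤ 4 * c + 3 := by
  have hm := expo_pos c
  have hA := bigA_pos c
  unfold vv psi
  have h1' : expo c * (-(bigA c / c) * exp (-(c * ξ)) + 2 * arsinh (ξ - 2 * c))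
      ≤ arsinh (ξ - 2 * c) * (2 * expo c) := by
    have : 0 ≤ bigA c / c * exp (-(c * ξ)) := by positivity
    nlinarith
  calc exp (expo c * (-(bigA c / c) * exp (-(c * ξ)) + 2 * arsinh (ξ - 2 * c)))
      ≤ exp (arsinh (ξ - 2 * c) * (2 * expo c)) := exp_le_exp.2 h1'
    _ = (exp (arsinh (ξ - 2 * c))) ^ (2 * expo c) := exp_mul _ _
    _ ≤ (2 * ξ + 4 * c + 1) ^ (2 * expo c) :=
        rpow_le_rpow (exp_pos _).le (exp_arsinh_le hc h0) (by positivity)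
    _ ≤ (4 * c + 3) ^ (2 * expo c) := rpow_le_rpow (by positivity) (by linarith) (by positivity)
    _ ≤ (4 * c + 3) ^ (1 : ℝ) := rpow_le_rpow_of_exponent_le (by linarith) (by linarith [expo_le c])
    _ = 4 * c + 3 := rpow_one _

/-- **Growth bound** `F(ξ) ≤ C₀ ξ^{2m}` on `[0,∞)` (the Hölder modulus of the barrier). [new] -/
theorem prof_le {c ξ : ℝ} (hc : 0 < c) (hξ : 0 ≤ ξ) : prof c ξ ≤ C0 c * ξ ^ (2 * expo c) := by
  have hm := expo_pos c
  have hl := lam_pos hc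
  rcases hξ.eq_or_lt with h0 | hpos
  · rw [← h0, prof_zero, zero_rpow (by positivity)]; simp
  unfold prof C0
  have hv := vv_pos c ξ
  rcases le_or_gt 1 ξ with h1 | h1
  · have hu1 := uu_le_one c hc hξ
    have hu0 := uu_nonneg c ξ
    have hvb := vv_le_of_one_le hc h1
    have hr : 0 ≤ ξ ^ (2 * expo c) := by positivity
    calc uu c ξ * vv c ξ ≤ 1 * ((4 * c + 3) * ξ ^ (2 * expo c)) := by gcongr
      _ ≤ (4 * c + 3) * (lam c ^ 2 + 1) * ξ ^ (2 * expo c) := by nlinarith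
  · have hu1 := uu_le_sq c hc hξ
    have hu0 := uu_nonneg c ξ
    have hvb := vv_le_of_le_one hc hξ h1.le
    have hr : ξ ^ 2 ≤ ξ ^ (2 * expo c) := by
      rw [← rpow_two]
      exact rpow_le_rpow_of_exponent_ge hpos h1.le (by linarith [expo_le c])
    calc uu c ξ * vv c ξ ≤ (lam c * ξ) ^ 2 * (4 * c + 3) := by gcongr
      _ = (4 * c + 3) * lam c ^ 2 * ξ ^ 2 := by ring
      _ ≤ (4 * c + 3) * lam c ^ 2 * ξ ^ (2 * expo c) := by gcongr
      _ ≤ (4 * c + 3) * (lam c ^ 2 + 1) * ξ ^ (2 * expo c) := by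
          have : 0 ≤ ξ ^ (2 * expo c) := by positivity
          nlinarith

/-- Lower bound `v ≥ e^{−mA/c} (ξ/(4c+1)²)^{2m}` on `(0,∞)`. -/
theorem vv_ge {c ξ : ℝ} (hc : 0 < c) (hξ : 0 ≤ ξ) :
    exp (-(expo c * bigA c / c)) * (ξ / (4 * c + 1) ^ 2) ^ (2 * expo c) ≤ vv c ξ := by
  have hm := expo_pos c
  have hA := bigA_pos c
  unfold vv psi
  have hE : exp (-(c * ξ)) ≤ 1 := by rw [exp_le_one_iff]; nlinarith
  have h1 : -(expo c * bigA c / c) + arsinh (ξ - 2 * c) * (2 * expo c)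
      ≤ expo c * (-(bigA c / c) * exp (-(c * ξ)) + 2 * arsinh (ξ - 2 * c)) := by
    have : bigA c / c * exp (-(c * ξ)) ≤ bigA c / c := by
      have := mul_le_mul_of_nonneg_left hE (by positivity : 0 ≤ bigA c / c); linarith
    have := mul_le_mul_of_nonneg_left this hm.le
    have e : expo c * (-(bigA c / c) * exp (-(c * ξ)) + 2 * arsinh (ξ - 2 * c))
        = -(expo c * (bigA c / c * exp (-(c * ξ)))) + arsinh (ξ - 2 * c) * (2 * expo c) := by ring
    rw [e]
    have e2 : expo c * bigA c / c = expo c * (bigA c / c) := by ring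
    rw [e2]
    linarith
  calc exp (-(expo c * bigA c / c)) * (ξ / (4 * c + 1) ^ 2) ^ (2 * expo c)
      ≤ exp (-(expo c * bigA c / c)) * (exp (arsinh (ξ - 2 * c))) ^ (2 * expo c) := by
        apply mul_le_mul_of_nonneg_left _ (exp_pos _).le
        exact rpow_le_rpow (by positivity) (le_exp_arsinh hc hξ) (by positivity)
    _ = exp (-(expo c * bigA c / c) + arsinh (ξ - 2 * c) * (2 * expo c)) := by
        rw [exp_add, exp_mul]
    _ ≤ _ := exp_le_exp.2 h1

/-- Lower bound `v ≥ e^{−m(A/c + 2 arsinh(2c))}` on `[0,∞)`. -/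
theorem vv_ge_const {c ξ : ℝ} (hc : 0 < c) (hξ : 0 ≤ ξ) :
    exp (-(expo c * (bigA c / c + 2 * arsinh (2 * c)))) ≤ vv c ξ := by
  have hm := expo_pos c
  have hA := bigA_pos c
  unfold vv psi
  apply exp_le_exp.2
  have hE : exp (-(c * ξ)) ≤ 1 := by rw [exp_le_one_iff]; nlinarith
  have h1 : bigA c / c * exp (-(c * ξ)) ≤ bigA c / c := by
    have := mul_le_mul_of_nonneg_left hE (by positivity : 0 ≤ bigA c / c); linarith
  have h2 : arsinh (-(2 * c)) ≤ arsinh (ξ - 2 * c) := arsinh_le_arsinh.2 (by linarith)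
  rw [arsinh_neg] at h2
  have e : expo c * (-(bigA c / c) * exp (-(c * ξ)) + 2 * arsinh (ξ - 2 * c))
      = -(expo c * (bigA c / c * exp (-(c * ξ)))) + 2 * (expo c * arsinh (ξ - 2 * c)) := by ring
  have e2 : -(expo c * (bigA c / c + 2 * arsinh (2 * c)))
      = -(expo c * (bigA c / c)) - 2 * (expo c * arsinh (2 * c)) := by ring
  rw [e, e2]
  have h3 := mul_le_mul_of_nonneg_left h1 hm.le
  have h4 := mul_le_mul_of_nonneg_left h2 hm.le
  linarith

/-- The constant `κ₁(ξ₁) = (λξ₁/(λξ₁+2))² e^{−mA/c} / ((4c+1)²)^{2m}`. [new] -/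
def kappa1 (c ξ₁ : ℝ) : ℝ :=
  (lam c * ξ₁ / (lam c * ξ₁ + 2)) ^ 2 * exp (-(expo c * bigA c / c)) / ((4 * c + 1) ^ 2) ^ (2 * expo c)

/-- `κ₁ > 0`. -/
theorem kappa1_pos {c ξ₁ : ℝ} (hc : 0 < c) (h1 : 0 < ξ₁) : 0 < kappa1 c ξ₁ := by
  unfold kappa1; have := lam_pos hc; positivity

/-- **Lower power bound** `F(ξ) ≥ κ₁(ξ₁) ξ^{2m}` for `ξ ≥ ξ₁ > 0`. [new] -/
theorem prof_ge_rpow {c ξ₁ ξ : ℝ} (hc : 0 < c) (h1 : 0 < ξ₁) (hξ : ξ₁ ≤ ξ) :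
    kappa1 c ξ₁ * ξ ^ (2 * expo c) ≤ prof c ξ := by
  have hl := lam_pos hc
  have hm := expo_pos c
  have hξ0 : 0 ≤ ξ := h1.le.trans hξ
  have hu := sq_le_uu c hc hξ0
  have hv := vv_ge hc hξ0
  have hmono : lam c * ξ₁ / (lam c * ξ₁ + 2) ≤ lam c * ξ / (lam c * ξ + 2) := by
    rw [div_le_div_iff₀ (by positivity) (by positivity)]; nlinarith
  have hsq : (lam c * ξ₁ / (lam c * ξ₁ + 2)) ^ 2 ≤ (lam c * ξ / (lam c * ξ + 2)) ^ 2 := by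
    have h0 : 0 ≤ lam c * ξ₁ / (lam c * ξ₁ + 2) := by positivity
    exact pow_le_pow_left₀ h0 hmono 2
  have hsplit : (ξ / (4 * c + 1) ^ 2) ^ (2 * expo c)
      = ξ ^ (2 * expo c) / ((4 * c + 1) ^ 2) ^ (2 * expo c) := div_rpow hξ0 (by positivity) _
  unfold kappa1 prof
  calc (lam c * ξ₁ / (lam c * ξ₁ + 2)) ^ 2 * exp (-(expo c * bigA c / c)) / ((4 * c + 1) ^ 2) ^ (2 * expo c)
        * ξ ^ (2 * expo c)
      = (lam c * ξ₁ / (lam c * ξ₁ + 2)) ^ 2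
        * (exp (-(expo c * bigA c / c)) * (ξ / (4 * c + 1) ^ 2) ^ (2 * expo c)) := by
          rw [hsplit]; ring
    _ ≤ uu c ξ * vv c ξ := by
        apply mul_le_mul (hsq.trans hu) hv (by positivity) (uu_nonneg c ξ)

/-- The constant `κ₂(ξ₂) = λ²/(λξ₂+2)² · e^{−m(A/c + 2 arsinh 2c)}`. [new] -/
def kappa2 (c ξ₂ : ℝ) : ℝ :=
  lam c ^ 2 / (lam c * ξ₂ + 2) ^ 2 * exp (-(expo c * (bigA c / c + 2 * arsinh (2 * c))))

/-- `κ₂ > 0`. -/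
theorem kappa2_pos {c ξ₂ : ℝ} (hc : 0 < c) (h2 : 0 < ξ₂) : 0 < kappa2 c ξ₂ := by
  unfold kappa2; have := lam_pos hc; positivity

/-- **Lower quadratic bound** `F(ξ) ≥ κ₂(ξ₂) ξ²` for `0 ≤ ξ ≤ ξ₂`. [new] -/
theorem prof_ge_sq {c ξ₂ ξ : ℝ} (hc : 0 < c) (h2 : 0 < ξ₂) (h0 : 0 ≤ ξ) (hξ : ξ ≤ ξ₂) :
    kappa2 c ξ₂ * ξ ^ 2 ≤ prof c ξ := by
  have hl := lam_pos hc
  have hu := sq_le_uu c hc h0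
  have hv := vv_ge_const hc h0
  have h1 : lam c ^ 2 / (lam c * ξ₂ + 2) ^ 2 * ξ ^ 2 ≤ (lam c * ξ / (lam c * ξ + 2)) ^ 2 := by
    rw [div_pow, div_mul_eq_mul_div, div_le_div_iff₀ (by positivity) (by positivity)]
    have : (lam c * ξ + 2) ^ 2 ≤ (lam c * ξ₂ + 2) ^ 2 := by gcongr
    nlinarith [sq_nonneg (lam c * ξ)]
  unfold kappa2 prof
  calc lam c ^ 2 / (lam c * ξ₂ + 2) ^ 2 * exp (-(expo c * (bigA c / c + 2 * arsinh (2 * c)))) * ξ ^ 2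
      = (lam c ^ 2 / (lam c * ξ₂ + 2) ^ 2 * ξ ^ 2) * exp (-(expo c * (bigA c / c + 2 * arsinh (2 * c)))) := by
        ring
    _ ≤ uu c ξ * vv c ξ := mul_le_mul (h1.trans hu) hv (by positivity) (uu_nonneg c ξ)

end Summit.NavierStokesRegularity.NavierStokesRegularity.Theorems.ZhangBarrier

end
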